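/-
Copyright (c) 2026 the pub-hodgecm-mathlib formalisation cell (harness21).  Prover seat hodgecm-mathlib-LH10-p01 (g12): road M6 → F5 → dyadic chain of `stub_DyUnramCore` (D-UNR),
research brick (L2-3)-θ part 2 «THE HERMITIAN CAYLEY SHIFT: INVARIANTS, RESIDUAL UNITS, DICTIONARY — 2-free» (MEMO-L23-θSHIFT v1); 2026-09-03.
-/
import Literature.NumberTheory.Automorphic.TypeTwoMoebiusShiftValued   -- ★ γ₁ (F0P2-p06): the `|2| = 1` originals twinned here; brings ★ α `MatrixMoebiusShift` (`det_mul_inv_eq_div`, `trace_mul_inv_mul_det_fin_two`) and ★ β `ResiduallySkewShiftUnits` (`valued_det_le_one`, `valued_trace_le_one`, …)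
import HarnessLib

/-!
# The hermitian Cayley shift of a type-(2) pair at ANY residue characteristic: the `2 × 2` invariants with four scalars, the residually skew units, the denominators
# `|det D| = |det N| = |c|²` and the dictionary `|disc χ_{φg}|·|c|² = |disc χ_g|`, `|χ_{φg}(φu)|·|c|² = |χ_g(u)|` for the pair `(θ, c − θ)`, `θ + σθ = 1`

Topic `NumberTheory/Automorphic`; namespace `Literature.NumberTheory.Automorphic.MoebiusShift` (= ★ α ∕ β ∕ γ₁'s).  THEOREMS ONLY (no definition, no instance, no notation, no named fact,
no `sorry`); kernel lane `--supports stmt-HodgeConjecture-24833`.  Cell `pub/hodgecm-mathlib` (D-0151), crux H413 = `stmt-HodgeConjecture-24833`; road M6 → F5 → the dyadic chain of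
organ (D-UNR) `stub_DyUnramCore`, LEVEL TWO, site (L2-3) «THE WALL» (FINDING #7), sequel of this seat's `MatrixMoebiusShiftHermitian` (p853610: the 2-free LEVEL lemma of the
hermitian shift `φ(g) = (θ•g + (c−θ)•1)((c−σθ)•g + σθ•1)⁻¹`).  THIS FILE twins, for that pair and WITHOUT `|2| = 1`, the three other `h2`-consumers of the type-(2) shift kit:
★ α §5 (the `2 × 2` invariants — here with FOUR free scalars, §1), ★ β (the residually skew cofactor UNITS — here from `θ + σθ = 1` instead of `4 + 4 ≠ 0`, §3) and ★ γ₁ §2–§3 ∕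
★ `TypeTwoMoebiusShiftValuedGeneric` §1–§2 (denominators and the `(n, N)` dictionary in the `|c|^k` currency, §4–§5).
HONEST LABEL: count-neutral research brick (elementary algebra over a field ∕ valuation arithmetic); no claim on L2-3 beyond the lemmas printed here; HC_CM is proved only modulo
the 7 printed citations (2 remaining named inputs: hLiu418 = stmt-HodgeConjecture-24832, h413 = stmt-HodgeConjecture-24833) until rung 0 closes.

THE MATHEMATICS.  §1 (any field, `2 × 2`): for `N = a•g + b•1`, `D = b′•g + a′•1`, `det D ≠ 0`: `disc χ_{N D⁻¹}·(det D)² = (a a′ − b b′)²·disc χ_g` and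
`χ_{N D⁻¹}((a u + b)∕(b′u + a′))·(b′u + a′)²·det D = (a a′ − b b′)²·χ_g(u)` (★ α §5 is `(a′, b′) = (a, b)`; the hermitian shift is `(θ, c−θ, σθ, c−σθ)`).  §2: `θσθ − (c−θ)(c−σθ)
= c(1 − c)`.  §3 (`σ` isometric, `θ` integral, `θ + σθ = 1`): for integral `s, p` with `|σs + s| < 1` (SKEW), `|σp − p| < 1` (FIXED), `|s² − 4p| < 1`, BOTH `A = 1 − σθ·s + σθ²·p` and
`B = 1 + θ·s + θ²·p` are units: `σ` transports `|A| < 1` to `|B| < 1` and back, while `(θσθ)²(s² − 4p) = 1 − 2(θ − σθ)R + R² − 4θσθ(θA + σθB)`, `R = θ²A − σθ²B` (exact, given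
`θ + σθ = 1`) forbids both — no `2`, no residue field, no eigenvalue (★ β's `4(4 + 2εs + p) ≡ (4 + εs)²` needs `|2| = 1`; the input `|σp − p| < 1` is automatic for unitary
`g = 1 + cX` — `valued_map_det_sub_det_lt_one_of_unitary_two` — and NEEDED: at residue characteristic `2`, `s̄ = 0`, `p̄ = 1∕σθ̄²` kills `A` unless `p̄` is `σ`-fixed).  Hence
`|det(1 + t•X)| = 1` for `t ≡ −σθ` or `t ≡ θ` (the cofactors of `D = c•(1 + (c−σθ)•X)`, `N = c•(1 + θ•X)` at `g = 1 + c•X`) and `|1 + t y| = 1` for skew `y`.  §4: `|det D| = |det N|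
= |c|²`, `|(c−σθ)u + σθ| = |θu + (c−θ)| = |c|` (`u = 1 + c y`).  §5: `|disc χ_{φg}|·|c|² = |disc χ_g|`, `|χ_{φg}(φu)|·|c|² = |χ_g(u)|` (inert reading `N ↦ N − 1`, `n ↦ n − 2`, ★ γ₁ §3).

## References
* [Weyl1939] H. Weyl, *The Classical Groups* (1939): Chap. II §10 p. 56 (Cayley's rational parametrisation).
* [Kottwitz1986BaseChangeUnits] R. E. Kottwitz, *Base change for unit elements of Hecke algebras*, Compositio Math. 60 (1986): §2 pp. 244–247.
* [Rogawski1990] J. D. Rogawski, *Automorphic Representations of Unitary Groups in Three Variables* (1990): §4.9 Prop. 4.9.1 (b) p. 55; §3.5–3.6.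
* [Flicker1998UnitaryFL] Y. Z. Flicker, *Elementary proof of the fundamental lemma for a unitary group*, Canad. J. Math. 50 (1998): §6.
* [HornJohnson2013] R. A. Horn, C. R. Johnson, *Matrix Analysis*, 2nd ed. (2013): §0.8.2 (adjugate), §1.2 (the characteristic polynomial).
* [SerreLocalFields1979] J.-P. Serre, *Local Fields*, GTM 67 (1979): Ch. I §§1–2.
-/

set_option autoImplicit false

noncomputable section

open Matrix Polynomial
open scoped WithZero

namespace Literature.NumberTheory.Automorphic.MoebiusShift

/-! ## §1 The invariants of `N D⁻¹` for `N = a•g + b•1`, `D = b′•g + a′•1` (`2 × 2`, four free scalars) -/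

section FinTwo

variable {K : Type*} [Field K]

/-- **The discriminant of the general Möbius shift**: `disc χ_{N D⁻¹}·(det D)² = (a a′ − b b′)²·disc χ_g` for `N = a•g + b•1`, `D = b′•g + a′•1`, `det D ≠ 0` (`2 × 2`,
eigenvalue-free; ★ α `disc_moebius_fin_two` is the case `a′ = a`, `b′ = b`). [cite: HornJohnson2013, §1.2] [cite: Kottwitz1986BaseChangeUnits, §2 pp. 244–247] -/
theorem disc_genMoebius_fin_two (g : Matrix (Fin 2) (Fin 2) K) (a b a' b' : K) (hD : (b' • g + a' • (1 : Matrix (Fin 2) (Fin 2) K)).det ≠ 0) :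
    (((a • g + b • (1 : Matrix (Fin 2) (Fin 2) K)) * (b' • g + a' • (1 : Matrix (Fin 2) (Fin 2) K))⁻¹).trace ^ 2 -
        4 * ((a • g + b • (1 : Matrix (Fin 2) (Fin 2) K)) * (b' • g + a' • (1 : Matrix (Fin 2) (Fin 2) K))⁻¹).det) *
      (b' • g + a' • (1 : Matrix (Fin 2) (Fin 2) K)).det ^ 2 = (a * a' - b * b') ^ 2 * (g.trace ^ 2 - 4 * g.det) := by
  set N : Matrix (Fin 2) (Fin 2) K := a • g + b • 1 with hN
  set D : Matrix (Fin 2) (Fin 2) K := b' • g + a' • 1 with hDdef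
  have htr := trace_mul_inv_mul_det_fin_two N D hD
  have hdet : (N * D⁻¹).det * D.det = N.det := by rw [det_mul_inv_eq_div, div_mul_cancel₀ _ hD]
  calc ((N * D⁻¹).trace ^ 2 - 4 * (N * D⁻¹).det) * D.det ^ 2
      = ((N * D⁻¹).trace * D.det) ^ 2 - 4 * ((N * D⁻¹).det * D.det) * D.det := by ring
    _ = (N.trace * D.trace - (N * D).trace) ^ 2 - 4 * N.det * D.det := by rw [htr, hdet]
    _ = (a * a' - b * b') ^ 2 * (g.trace ^ 2 - 4 * g.det) := by
        simp [hN, hDdef, Matrix.trace_fin_two, Matrix.det_fin_two, Matrix.mul_apply, Fin.sum_univ_two, Matrix.one_apply]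
        ring

/-- **The value of the general shift at the shifted point**: `χ_{N D⁻¹}((a u + b)∕(b′u + a′))·(b′u + a′)²·det D = (a a′ − b b′)²·χ_g(u)` (`2 × 2`, `det D ≠ 0`, `b′u + a′ ≠ 0`;
★ α `eval_charpoly_moebius_fin_two` is `a′ = a`, `b′ = b`). [cite: HornJohnson2013, §1.2] [cite: Kottwitz1986BaseChangeUnits, §2 pp. 244–247] -/
theorem eval_charpoly_genMoebius_fin_two (g : Matrix (Fin 2) (Fin 2) K) (a b a' b' u : K) (hD : (b' • g + a' • (1 : Matrix (Fin 2) (Fin 2) K)).det ≠ 0) (hu : b' * u + a' ≠ 0) :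
    ((a • g + b • (1 : Matrix (Fin 2) (Fin 2) K)) * (b' • g + a' • (1 : Matrix (Fin 2) (Fin 2) K))⁻¹).charpoly.eval ((a * u + b) / (b' * u + a')) * (b' * u + a') ^ 2 *
      (b' • g + a' • (1 : Matrix (Fin 2) (Fin 2) K)).det = (a * a' - b * b') ^ 2 * g.charpoly.eval u := by
  set N : Matrix (Fin 2) (Fin 2) K := a • g + b • 1 with hN
  set D : Matrix (Fin 2) (Fin 2) K := b' • g + a' • 1 with hDdef
  have htr := trace_mul_inv_mul_det_fin_two N D hD
  have hdet : (N * D⁻¹).det * D.det = N.det := by rw [det_mul_inv_eq_div, div_mul_cancel₀ _ hD]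
  rw [Matrix.charpoly_fin_two, Matrix.charpoly_fin_two]
  simp only [eval_add, eval_sub, eval_mul, eval_pow, eval_C, eval_X]
  have e1 : ((a * u + b) / (b' * u + a')) ^ 2 * (b' * u + a') ^ 2 = (a * u + b) ^ 2 := by
    rw [div_pow, div_mul_cancel₀ _ (pow_ne_zero 2 hu)]
  have e2 : (a * u + b) / (b' * u + a') * (b' * u + a') ^ 2 = (a * u + b) * (b' * u + a') := by
    rw [pow_two, ← mul_assoc, div_mul_cancel₀ _ hu]
  calc (((a * u + b) / (b' * u + a')) ^ 2 - (N * D⁻¹).trace * ((a * u + b) / (b' * u + a')) + (N * D⁻¹).det) * (b' * u + a') ^ 2 * D.det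
      = ((a * u + b) / (b' * u + a')) ^ 2 * (b' * u + a') ^ 2 * D.det - ((N * D⁻¹).trace * D.det) * ((a * u + b) / (b' * u + a') * (b' * u + a') ^ 2) +
          ((N * D⁻¹).det * D.det) * (b' * u + a') ^ 2 := by ring
    _ = (a * u + b) ^ 2 * D.det - (N.trace * D.trace - (N * D).trace) * ((a * u + b) * (b' * u + a')) + N.det * (b' * u + a') ^ 2 := by rw [e1, e2, htr, hdet]
    _ = (a * a' - b * b') ^ 2 * (u ^ 2 - g.trace * u + g.det) := by
        simp [hN, hDdef, Matrix.trace_fin_two, Matrix.det_fin_two, Matrix.mul_apply, Fin.sum_univ_two, Matrix.one_apply]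
        ring

/-! ## §2 The key scalar of the hermitian pair `(θ, c − θ ∣ c − σθ, σθ)` -/

/-- **`θσθ − (c − θ)(c − σθ) = c(1 − c)`** when `θ + σθ = 1` — the `a a′ − b b′` of the hermitian shift (★'s σ-fixed pair has `(c+1)² − (c−1)² = 4c`).
[cite: Kottwitz1986BaseChangeUnits, §2 pp. 244–247] -/
theorem hermitianPair_key_scalar (σ : K →+* K) {θ : K} (hθ : θ + σ θ = 1) (c : K) : θ * σ θ - (c - θ) * (c - σ θ) = c * (1 - c) := by
  linear_combination c * hθ

/-- `σ(σθ) = θ` when `θ + σθ = 1`. [cite: SerreLocalFields1979, Ch. I §§1–2] -/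
theorem map_map_eq_of_add_map_eq_one (σ : K →+* K) {θ : K} (hθ : θ + σ θ = 1) : σ (σ θ) = θ := by
  have h := congrArg σ hθ
  rw [map_add, map_one] at h
  linear_combination h - hθ

/-- The exact identity behind the `2 × 2` residual units: `(l m)²(s² − 4p) = 1 − 2(m − l)R + R² − 4 l m (m A + l B)` for `l + m = 1`, `A = 1 − l s + l²p`, `B = 1 + m s + m²p`,
`R = m²A − l²B`. [cite: HornJohnson2013, §0.8.2] -/
private theorem residual_unit_identity {l m s p : K} (hlm : l + m = 1) :
    (l * m) ^ 2 * (s ^ 2 - 4 * p) =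
      1 - 2 * (m - l) * (m ^ 2 * (1 - l * s + l ^ 2 * p) - l ^ 2 * (1 + m * s + m ^ 2 * p)) + (m ^ 2 * (1 - l * s + l ^ 2 * p) - l ^ 2 * (1 + m * s + m ^ 2 * p)) ^ 2 -
        4 * (l * m) * (m * (1 - l * s + l ^ 2 * p) + l * (1 + m * s + m ^ 2 * p)) := by
  have hm : m = 1 - l := by linear_combination hlm
  subst hm
  ring

end FinTwo

section Valued

variable {K : Type*} [Field K] [Valued K ℤᵐ⁰]

/-- `|θσθ − (c − θ)(c − σθ)| = |c|` and `|(·)²| = |c|²` for `θ + σθ = 1`, `|c| < 1` (`|1 − c| = 1`). [cite: SerreLocalFields1979, Ch. I §§1–2] -/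
theorem valued_hermitianPair_key_scalar_sq (σ : K →+* K) {θ : K} (hθ : θ + σ θ = 1) {c : K} (hc1 : Valued.v c < 1) :
    Valued.v ((θ * σ θ - (c - θ) * (c - σ θ)) ^ 2) = Valued.v c ^ 2 := by
  rw [hermitianPair_key_scalar σ hθ c, map_pow, map_mul, Valuation.map_one_sub_of_lt _ hc1, mul_one]

/-! ## §3 The residually skew units of the hermitian shift — no `|2| = 1` -/

/-- **`σ(det X) ≡ det X` from unitarity** (`2 × 2`): for `g = 1 + c·X ∈ U(σ, J)` with `X` integral, `J` integral unimodular, `σ` isometric fixing `c`, `0 < |c| < 1`: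
`|σ(det X) − det X| < 1` (residually `ᵗ(σX̄)J̄ = −J̄X̄`, so `det σX̄ = det(−X̄) = det X̄`).  Companion of ★ β `valued_map_trace_add_trace_lt_one_of_unitary`.
[cite: Rogawski1990, §3.5–3.6] [cite: Kottwitz1986BaseChangeUnits, §2 pp. 244–247] -/
theorem valued_map_det_sub_det_lt_one_of_unitary_two (σ : K →+* K) (hσ : ∀ x, Valued.v (σ x) = Valued.v x)
    {J : Matrix (Fin 2) (Fin 2) K} (hJ : ∀ i j, Valued.v (J i j) ≤ 1) (hJd : Valued.v J.det = 1)
    {c : K} (hc0 : c ≠ 0) (hc : Valued.v c < 1) (hσc : σ c = c)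
    {X : Matrix (Fin 2) (Fin 2) K} (hX : ∀ i j, Valued.v (X i j) ≤ 1)
    (hg : (((1 : Matrix (Fin 2) (Fin 2) K) + c • X).map σ)ᵀ * J * ((1 : Matrix (Fin 2) (Fin 2) K) + c • X) = J) :
    Valued.v (σ X.det - X.det) < 1 := by
  set A : Matrix (Fin 2) (Fin 2) K := (X.map σ)ᵀ with hA
  have hAint : ∀ i j, Valued.v (A i j) ≤ 1 := fun i j => by rw [hA, Matrix.transpose_apply, Matrix.map_apply, hσ]; exact hX j i
  -- expand the unitarity relation: `AJ + JX = −c·AJX`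
  have hmapσ : ((1 : Matrix (Fin 2) (Fin 2) K) + c • X).map σ = 1 + c • X.map σ := by
    ext i j
    simp only [Matrix.map_apply, Matrix.add_apply, Matrix.smul_apply, smul_eq_mul, map_add, map_mul, hσc, Matrix.one_apply]
    split_ifs <;> simp
  have hmapσT : (((1 : Matrix (Fin 2) (Fin 2) K) + c • X).map σ)ᵀ = 1 + c • A := by
    rw [hmapσ, Matrix.transpose_add, Matrix.transpose_one, Matrix.transpose_smul]
  have hprod : ((1 : Matrix (Fin 2) (Fin 2) K) + c • A) * J * (1 + c • X) = J + c • (A * J + J * X + c • (A * J * X)) := by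
    simp only [add_mul, mul_add, one_mul, mul_one, smul_mul_assoc, mul_smul_comm, smul_add, smul_smul, Matrix.mul_assoc]
    abel
  have hexp : J + c • (A * J + J * X + c • (A * J * X)) = J := by
    rw [← hprod, ← hmapσT]; exact hg
  have hrel : A * J = -(J * X) - c • (A * J * X) := by
    have h : c • (A * J + J * X + c • (A * J * X)) = 0 := by
      have h' := hexp; rw [add_eq_left] at h'; exact h'
    have h2 := (smul_eq_zero.1 h).resolve_left hc0
    rw [eq_sub_iff_add_eq, eq_neg_iff_add_eq_zero, ← h2]
    abel
  -- determinants: `σ(det X)·det J = det(−JX − c·AJX) = det(JX)·… + c·(integral)`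
  have hdetA : A.det = σ X.det := by rw [hA, Matrix.det_transpose, RingHom.map_det, RingHom.mapMatrix_apply]
  set M : Matrix (Fin 2) (Fin 2) K := A * J * X with hM
  have hMint : ∀ i j, Valued.v (M i j) ≤ 1 := valued_mul_apply_le_one (valued_mul_apply_le_one hAint hJ) hX
  set P : Matrix (Fin 2) (Fin 2) K := J * X with hP
  have hPint : ∀ i j, Valued.v (P i j) ≤ 1 := valued_mul_apply_le_one hJ hX
  -- the `2 × 2` determinant perturbation, explicitly
  set W : K := P 0 0 * M 1 1 + M 0 0 * P 1 1 + c * (M 0 0 * M 1 1) - P 0 1 * M 1 0 - M 0 1 * P 1 0 - c * (M 0 1 * M 1 0) with hW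
  have hdet : (-P - c • M).det = P.det + c * W := by
    rw [Matrix.det_fin_two, Matrix.det_fin_two]
    simp only [Matrix.sub_apply, Matrix.neg_apply, Matrix.smul_apply, smul_eq_mul, hW]
    ring
  have hWint : Valued.v W ≤ 1 := by
    have hc1 : Valued.v c ≤ 1 := hc.le
    have m : ∀ {x y : K}, Valued.v x ≤ 1 → Valued.v y ≤ 1 → Valued.v (x * y) ≤ 1 := fun hx hy => by rw [map_mul]; exact mul_le_one' hx hy
    rw [hW]
    exact Valuation.map_sub_le _ (Valuation.map_sub_le _ (Valuation.map_sub_le _ (Valuation.map_add_le _ (Valuation.map_add_le _ (m (hPint 0 0) (hMint 1 1))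
      (m (hMint 0 0) (hPint 1 1))) (m hc1 (m (hMint 0 0) (hMint 1 1)))) (m (hPint 0 1) (hMint 1 0))) (m (hMint 0 1) (hPint 1 0))) (m hc1 (m (hMint 0 1) (hMint 1 0)))
  have hkey : J.det * (σ X.det - X.det) = c * W := by
    have h := congrArg Matrix.det hrel
    rw [Matrix.det_mul, hdetA, hdet, hP, Matrix.det_mul] at h
    linear_combination h
  have h := congrArg Valued.v hkey
  rw [map_mul, hJd, one_mul, map_mul] at h
  rw [h]
  exact lt_of_le_of_lt (mul_le_of_le_one_right' hWint) hc

/-- **THE TWO SCALAR UNITS of the hermitian shift**: for `σ` isometric, `θ` integral with `θ + σθ = 1`, and integral `s, p` with `s` residually skew, `p` residually `σ`-fixed and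
`|s² − 4p| < 1`: `|1 − σθ·s + σθ²·p| = 1` and `|1 + θ·s + θ²·p| = 1` — at every residue characteristic (★ β `valued_four_add_eq_one` is the `|2| = 1` analogue for the pair `(c+1, c−1)`).
[cite: SerreLocalFields1979, Ch. I §§1–2] [cite: Kottwitz1986BaseChangeUnits, §2 pp. 244–247] -/
theorem valued_hermitian_cofactors_eq_one (σ : K →+* K) (hσ : ∀ x, Valued.v (σ x) = Valued.v x) {θ : K} (hθ1 : Valued.v θ ≤ 1) (hθ : θ + σ θ = 1)
    {s p : K} (hs : Valued.v s ≤ 1) (hp : Valued.v p ≤ 1) (hskew : Valued.v (σ s + s) < 1) (hfix : Valued.v (σ p - p) < 1) (hdisc : Valued.v (s ^ 2 - 4 * p) < 1) :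
    Valued.v (1 - σ θ * s + σ θ ^ 2 * p) = 1 ∧ Valued.v (1 + θ * s + θ ^ 2 * p) = 1 := by
  have hσθ1 : Valued.v (σ θ) ≤ 1 := by rw [hσ]; exact hθ1
  have hσσ : σ (σ θ) = θ := map_map_eq_of_add_map_eq_one σ hθ
  have m : ∀ {x y : K}, Valued.v x ≤ 1 → Valued.v y ≤ 1 → Valued.v (x * y) ≤ 1 := fun hx hy => by rw [map_mul]; exact mul_le_one' hx hy
  have pw : ∀ {x : K} (n : ℕ), Valued.v x ≤ 1 → Valued.v (x ^ n) ≤ 1 := fun n hx => by rw [map_pow]; exact pow_le_one' hx n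
  have ml : ∀ {x y : K}, Valued.v x ≤ 1 → Valued.v y < 1 → Valued.v (x * y) < 1 := fun hx hy => by rw [map_mul]; exact lt_of_le_of_lt (mul_le_of_le_one_left' hx) hy
  set A : K := 1 - σ θ * s + σ θ ^ 2 * p with hA
  set B : K := 1 + θ * s + θ ^ 2 * p with hB
  have hAi : Valued.v A ≤ 1 := Valuation.map_add_le _ (Valuation.map_sub_le _ (le_of_eq (map_one _)) (m hσθ1 hs)) (m (pw 2 hσθ1) hp)
  have hBi : Valued.v B ≤ 1 := Valuation.map_add_le _ (Valuation.map_add_le _ (le_of_eq (map_one _)) (m hθ1 hs)) (m (pw 2 hθ1) hp)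
  -- `σ` transports smallness: `B − σA = θ(σs + s) − θ²(σp − p)`, `A − σB = −σθ(σs + s) + σθ²(σp − p)`… up to `σσ`-terms on `s`, `p`
  have hσA : σ A = 1 - θ * σ s + θ ^ 2 * σ p := by rw [hA]; simp [map_sub, map_add, map_mul, map_pow, hσσ]
  have hσB : σ B = 1 + σ θ * σ s + σ θ ^ 2 * σ p := by rw [hB]; simp [map_add, map_mul, map_pow]
  have hBA : B - σ A = θ * (σ s + s) - θ ^ 2 * (σ p - p) := by rw [hσA, hB]; ring
  have hAB : A - σ B = -(σ θ * (σ s + s)) + σ θ ^ 2 * -(σ p - p) := by rw [hσB, hA]; ring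
  have hBA' : Valued.v (B - σ A) < 1 := by rw [hBA]; exact Valuation.map_sub_lt _ (ml hθ1 hskew) (ml (pw 2 hθ1) hfix)
  have hAB' : Valued.v (A - σ B) < 1 := by
    rw [hAB]; refine Valuation.map_add_lt _ ?_ (ml (pw 2 hσθ1) ?_)
    · rw [Valuation.map_neg]; exact ml hσθ1 hskew
    · rw [Valuation.map_neg]; exact hfix
  have hA_to_B : Valued.v A < 1 → Valued.v B < 1 := fun h => by
    have h' : Valued.v (σ A) < 1 := by rw [hσ]; exact h
    have e : B = (B - σ A) + σ A := by ring
    rw [e]; exact Valuation.map_add_lt _ hBA' h'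
  have hB_to_A : Valued.v B < 1 → Valued.v A < 1 := fun h => by
    have h' : Valued.v (σ B) < 1 := by rw [hσ]; exact h
    have e : A = (A - σ B) + σ B := by ring
    rw [e]; exact Valuation.map_add_lt _ hAB' h'
  -- both small is impossible: the identity makes `1 + (small)` equal to `(θσθ)²·(s² − 4p)`, which is small
  have hnot : ¬ (Valued.v A < 1 ∧ Valued.v B < 1) := fun ⟨hA1, hB1⟩ => by
    have hid := residual_unit_identity (s := s) (p := p) (add_comm θ (σ θ) ▸ hθ : σ θ + θ = 1)
    set R : K := θ ^ 2 * A - σ θ ^ 2 * B with hR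
    have hRs : Valued.v R < 1 := Valuation.map_sub_lt _ (ml (pw 2 hθ1) hA1) (ml (pw 2 hσθ1) hB1)
    set T : K := -(2 * (θ - σ θ) * R) + R ^ 2 - 4 * (σ θ * θ) * (θ * A + σ θ * B) with hT
    have h2i : Valued.v (2 : K) ≤ 1 := by rw [show (2 : K) = 1 + 1 by norm_num]; exact Valuation.map_add_le _ (le_of_eq (map_one _)) (le_of_eq (map_one _))
    have h4i : Valued.v (4 : K) ≤ 1 := by rw [show (4 : K) = 2 * 2 by norm_num]; exact m h2i h2i
    have hTs : Valued.v T < 1 := by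
      rw [hT]
      refine Valuation.map_sub_lt _ (Valuation.map_add_lt _ ?_ ?_) ?_
      · rw [Valuation.map_neg]; exact ml (m h2i (Valuation.map_sub_le _ hθ1 hσθ1)) hRs
      · rw [map_pow]; exact pow_lt_one₀ zero_le hRs two_ne_zero
      · exact ml (m h4i (m hσθ1 hθ1)) (Valuation.map_add_lt _ (ml hθ1 hA1) (ml hσθ1 hB1))
    have hrhs : Valued.v (1 + T) = 1 := by
      rw [Valuation.map_add_eq_of_lt_left _ (by rwa [map_one]), map_one]
    have hlhs : Valued.v ((σ θ * θ) ^ 2 * (s ^ 2 - 4 * p)) < 1 := ml (pw 2 (m hσθ1 hθ1)) hdisc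
    have e : (σ θ * θ) ^ 2 * (s ^ 2 - 4 * p) = 1 + T := by rw [hid, hT, hR, hA, hB]; ring
    rw [e, hrhs] at hlhs
    exact lt_irrefl _ hlhs
  refine ⟨hAi.lt_or_eq.resolve_left fun h => hnot ⟨h, hA_to_B h⟩, hBi.lt_or_eq.resolve_left fun h => hnot ⟨hB_to_A h, h⟩⟩

/-- **The matrix cofactor units**: `|det(1 + t•X)| = 1` for a `2 × 2` integral `X` with residually skew trace, residually `σ`-fixed determinant and `|tr² − 4 det| < 1`, and
`t ≡ −σθ` (the cofactor of `D = (c−σθ)•g + σθ•1 = c•(1 + (c−σθ)•X)` at `g = 1 + c•X`) or `t ≡ θ` (that of `N = θ•g + (c−θ)•1 = c•(1 + θ•X)`) — ★ β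
`valued_det_two_smul_one_add_smul_eq_one` without `|2| = 1`. [cite: Kottwitz1986BaseChangeUnits, §2 pp. 244–247] [cite: SerreLocalFields1979, Ch. I §§1–2] -/
theorem valued_det_one_add_smul_eq_one_of_skew_hermitian (σ : K →+* K) (hσ : ∀ x, Valued.v (σ x) = Valued.v x) {θ : K} (hθ1 : Valued.v θ ≤ 1) (hθ : θ + σ θ = 1)
    {X : Matrix (Fin 2) (Fin 2) K} (hX : ∀ i j, Valued.v (X i j) ≤ 1) (hskew : Valued.v (σ X.trace + X.trace) < 1) (hfix : Valued.v (σ X.det - X.det) < 1)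
    (hdisc : Valued.v (X.trace ^ 2 - 4 * X.det) < 1) {t : K} (ht : Valued.v t ≤ 1) (ht1 : Valued.v (t + σ θ) < 1 ∨ Valued.v (t - θ) < 1) :
    Valued.v (((1 : Matrix (Fin 2) (Fin 2) K) + t • X).det) = 1 := by
  have hdet : ((1 : Matrix (Fin 2) (Fin 2) K) + t • X).det = 1 + t * X.trace + t ^ 2 * X.det := by
    simp only [Matrix.trace_fin_two, Matrix.det_fin_two, Matrix.add_apply, Matrix.smul_apply, Matrix.one_apply_eq, Matrix.one_apply_ne (by decide : (0 : Fin 2) ≠ 1),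
      Matrix.one_apply_ne (by decide : (1 : Fin 2) ≠ 0), smul_eq_mul]
    ring
  rw [hdet]
  have hs : Valued.v X.trace ≤ 1 := valued_trace_le_one hX
  have hp : Valued.v X.det ≤ 1 := valued_det_le_one hX
  have hσθ1 : Valued.v (σ θ) ≤ 1 := by rw [hσ]; exact hθ1
  obtain ⟨hA, hB⟩ := valued_hermitian_cofactors_eq_one σ hσ hθ1 hθ hs hp hskew hfix hdisc
  have pert : ∀ {e r : K}, Valued.v e < 1 → Valued.v r ≤ 1 → Valued.v (e * (X.trace + r * X.det)) < 1 := fun he hr => by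
    rw [map_mul]
    exact lt_of_le_of_lt (mul_le_of_le_one_right' (Valuation.map_add_le _ hs (by rw [map_mul]; exact mul_le_one' hr hp))) he
  rcases ht1 with h | h
  · have e : 1 + t * X.trace + t ^ 2 * X.det = (1 - σ θ * X.trace + σ θ ^ 2 * X.det) + (t + σ θ) * (X.trace + (t - σ θ) * X.det) := by ring
    rw [e, Valuation.map_add_eq_of_lt_left _ (by rw [hA]; exact pert h (Valuation.map_sub_le _ ht hσθ1)), hA]
  · have e : 1 + t * X.trace + t ^ 2 * X.det = (1 + θ * X.trace + θ ^ 2 * X.det) + (t - θ) * (X.trace + (t + θ) * X.det) := by ring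
    rw [e, Valuation.map_add_eq_of_lt_left _ (by rw [hB]; exact pert h (Valuation.map_add_le _ ht hθ1)), hB]

/-- **The scalar cofactor units**: `|1 + t·y| = 1` for `y` integral residually skew and `t ≡ −σθ` or `t ≡ θ` (`θ + σθ = 1`; no integrality of `t` needed): `θ(1 − σθ·y) + σθ(1 + θ·y) = 1` — ★ β
`valued_two_add_mul_eq_one` without `|2| = 1`. [cite: SerreLocalFields1979, Ch. I §§1–2] -/
theorem valued_one_add_mul_eq_one_of_skew_hermitian (σ : K →+* K) (hσ : ∀ x, Valued.v (σ x) = Valued.v x) {θ : K} (hθ1 : Valued.v θ ≤ 1) (hθ : θ + σ θ = 1)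
    {y : K} (hy : Valued.v y ≤ 1) (hskew : Valued.v (σ y + y) < 1) {t : K} (ht1 : Valued.v (t + σ θ) < 1 ∨ Valued.v (t - θ) < 1) :
    Valued.v (1 + t * y) = 1 := by
  have hσθ1 : Valued.v (σ θ) ≤ 1 := by rw [hσ]; exact hθ1
  have hσσ : σ (σ θ) = θ := map_map_eq_of_add_map_eq_one σ hθ
  have ml : ∀ {x z : K}, Valued.v x ≤ 1 → Valued.v z < 1 → Valued.v (x * z) < 1 := fun hx hz => by rw [map_mul]; exact lt_of_le_of_lt (mul_le_of_le_one_left' hx) hz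
  have hAi : Valued.v (1 - σ θ * y) ≤ 1 := Valuation.map_sub_le _ (le_of_eq (map_one _)) (by rw [map_mul]; exact mul_le_one' hσθ1 hy)
  have hBi : Valued.v (1 + θ * y) ≤ 1 := Valuation.map_add_le _ (le_of_eq (map_one _)) (by rw [map_mul]; exact mul_le_one' hθ1 hy)
  have hsum : θ * (1 - σ θ * y) + σ θ * (1 + θ * y) = 1 := by linear_combination hθ
  have hnot : ¬ (Valued.v (1 - σ θ * y) < 1 ∧ Valued.v (1 + θ * y) < 1) := fun ⟨hA1, hB1⟩ => by
    have h : Valued.v (θ * (1 - σ θ * y) + σ θ * (1 + θ * y)) < 1 := Valuation.map_add_lt _ (ml hθ1 hA1) (ml hσθ1 hB1)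
    rw [hsum, map_one] at h
    exact lt_irrefl _ h
  have hA_to_B : Valued.v (1 - σ θ * y) < 1 → Valued.v (1 + θ * y) < 1 := fun h => by
    have h' : Valued.v (σ (1 - σ θ * y)) < 1 := by rw [hσ]; exact h
    have e : 1 + θ * y = θ * (σ y + y) + σ (1 - σ θ * y) := by simp only [map_sub, map_one, map_mul, hσσ]; ring
    rw [e]; exact Valuation.map_add_lt _ (ml hθ1 hskew) h'
  have hB_to_A : Valued.v (1 + θ * y) < 1 → Valued.v (1 - σ θ * y) < 1 := fun h => by
    have h' : Valued.v (σ (1 + θ * y)) < 1 := by rw [hσ]; exact h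
    have e : 1 - σ θ * y = -(σ θ * (σ y + y)) + σ (1 + θ * y) := by simp only [map_add, map_one, map_mul]; ring
    rw [e]; refine Valuation.map_add_lt _ ?_ h'
    rw [Valuation.map_neg]; exact ml hσθ1 hskew
  have hA : Valued.v (1 - σ θ * y) = 1 := hAi.lt_or_eq.resolve_left fun h => hnot ⟨h, hA_to_B h⟩
  have hB : Valued.v (1 + θ * y) = 1 := hBi.lt_or_eq.resolve_left fun h => hnot ⟨hB_to_A h, h⟩
  have ml' : ∀ {e : K}, Valued.v e < 1 → Valued.v (e * y) < 1 := fun he => by rw [map_mul]; exact lt_of_le_of_lt (mul_le_of_le_one_right' hy) he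
  rcases ht1 with h | h
  · rw [show 1 + t * y = (1 - σ θ * y) + (t + σ θ) * y by ring, Valuation.map_add_eq_of_lt_left _ (by rw [hA]; exact ml' h), hA]
  · rw [show 1 + t * y = (1 + θ * y) + (t - θ) * y by ring, Valuation.map_add_eq_of_lt_left _ (by rw [hB]; exact ml' h), hB]

/-! ## §4 The denominators of the hermitian shift: `|det D| = |det N| = |c|²`, `|(c−σθ)u + σθ| = |θu + (c−θ)| = |c|` -/

omit [Valued K ℤᵐ⁰] in
/-- `a•(1 + c•X) + b•1 = c•(1 + a•X)` when `a + b = c` (the hermitian pairs `(c−σθ, σθ)` and `(θ, c−θ)`; ★ γ₁ `smul_one_add_smul_add_smul_one` is `a + b = 2c`).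
[cite: Kottwitz1986BaseChangeUnits, §2 pp. 244–247] -/
theorem smul_one_add_smul_add_smul_one_of_add_eq {m : Type*} [DecidableEq m] [Fintype m] (X : Matrix m m K) (c a b : K) (hab : a + b = c) :
    a • ((1 : Matrix m m K) + c • X) + b • (1 : Matrix m m K) = c • ((1 : Matrix m m K) + a • X) := by
  rw [smul_add, smul_add, smul_smul, smul_smul, mul_comm a c]
  have : a • (1 : Matrix m m K) + b • (1 : Matrix m m K) = c • (1 : Matrix m m K) := by rw [← add_smul, hab]
  rw [add_right_comm, this]

/-- **The matrix denominators**: `|det((c−σθ)•g + σθ•1)| = |c|² = |det(θ•g + (c−θ)•1)|` for `g = 1 + c•X` with unit cofactors `|det(1 + (c−σθ)•X)| = |det(1 + θ•X)| = 1`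
(★ γ₁ `valued_det_shift_denominators` ∕ ★ `…_of_valued_lt_one` for the σ-fixed pair). [cite: Kottwitz1986BaseChangeUnits, §2 pp. 244–247] -/
theorem valued_det_hermitianShift_denominators (σ : K →+* K) {θ c : K} {X : Matrix (Fin 2) (Fin 2) K}
    (hD : Valued.v (((1 : Matrix (Fin 2) (Fin 2) K) + (c - σ θ) • X).det) = 1) (hN : Valued.v (((1 : Matrix (Fin 2) (Fin 2) K) + θ • X).det) = 1) :
    Valued.v (((c - σ θ) • ((1 : Matrix (Fin 2) (Fin 2) K) + c • X) + σ θ • (1 : Matrix (Fin 2) (Fin 2) K)).det) = Valued.v c ^ 2 ∧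
      Valued.v ((θ • ((1 : Matrix (Fin 2) (Fin 2) K) + c • X) + (c - θ) • (1 : Matrix (Fin 2) (Fin 2) K)).det) = Valued.v c ^ 2 := by
  constructor
  · rw [smul_one_add_smul_add_smul_one_of_add_eq X c (c - σ θ) (σ θ) (by ring), Matrix.det_smul, Fintype.card_fin, map_mul, map_pow, hD, mul_one]
  · rw [smul_one_add_smul_add_smul_one_of_add_eq X c θ (c - θ) (by ring), Matrix.det_smul, Fintype.card_fin, map_mul, map_pow, hN, mul_one]

/-- **The scalar denominators**: `|(c−σθ)u + σθ| = |c| = |θu + (c−θ)|` for `u = 1 + c y` with unit cofactors `|1 + (c−σθ)y| = |1 + θy| = 1` (★ γ₁ `valued_shift_denominators_one`).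
[cite: Kottwitz1986BaseChangeUnits, §2 pp. 244–247] -/
theorem valued_hermitianShift_denominators_one (σ : K →+* K) (θ : K) {c y : K}
    (hD : Valued.v (1 + (c - σ θ) * y) = 1) (hN : Valued.v (1 + θ * y) = 1) :
    Valued.v ((c - σ θ) * (1 + c * y) + σ θ) = Valued.v c ∧ Valued.v (θ * (1 + c * y) + (c - θ)) = Valued.v c := by
  constructor
  · rw [show (c - σ θ) * (1 + c * y) + σ θ = c * (1 + (c - σ θ) * y) by ring, map_mul, hD, mul_one]
  · rw [show θ * (1 + c * y) + (c - θ) = c * (1 + θ * y) by ring, map_mul, hN, mul_one]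

/-- **All four denominators at once, from unitarity** (`2 × 2` block in `U(σ, J)`, `1 × 1` block of norm one): for `g = 1 + c•X ∈ U(σ, J)` (`X` integral, `J` integral unimodular,
`|disc χ_X| < 1`), `u = 1 + c y` with `σ(u)·u = 1` (`y` integral), `σ` isometric fixing `c`, `0 < |c| < 1`, `θ` integral with `θ + σθ = 1`:
`|det((c−σθ)•g + σθ•1)| = |det(θ•g + (c−θ)•1)| = |c|²` and `|(c−σθ)u + σθ| = |θu + (c−θ)| = |c|`. [cite: Kottwitz1986BaseChangeUnits, §2 pp. 244–247] [cite: Rogawski1990, §3.5–3.6] -/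
theorem valued_hermitianShift_denominators_of_unitary (σ : K →+* K) (hσ : ∀ x, Valued.v (σ x) = Valued.v x) {θ : K} (hθ1 : Valued.v θ ≤ 1) (hθ : θ + σ θ = 1)
    {J : Matrix (Fin 2) (Fin 2) K} (hJ : ∀ i j, Valued.v (J i j) ≤ 1) (hJd : Valued.v J.det = 1)
    {c : K} (hc0 : c ≠ 0) (hc : Valued.v c < 1) (hσc : σ c = c)
    {X : Matrix (Fin 2) (Fin 2) K} (hX : ∀ i j, Valued.v (X i j) ≤ 1) (hdisc : Valued.v (X.trace ^ 2 - 4 * X.det) < 1)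
    (hg : (((1 : Matrix (Fin 2) (Fin 2) K) + c • X).map σ)ᵀ * J * ((1 : Matrix (Fin 2) (Fin 2) K) + c • X) = J)
    {y : K} (hy : Valued.v y ≤ 1) (hu : σ (1 + c * y) * (1 + c * y) = 1) :
    Valued.v (((c - σ θ) • ((1 : Matrix (Fin 2) (Fin 2) K) + c • X) + σ θ • (1 : Matrix (Fin 2) (Fin 2) K)).det) = Valued.v c ^ 2 ∧
      Valued.v ((θ • ((1 : Matrix (Fin 2) (Fin 2) K) + c • X) + (c - θ) • (1 : Matrix (Fin 2) (Fin 2) K)).det) = Valued.v c ^ 2 ∧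
      Valued.v ((c - σ θ) * (1 + c * y) + σ θ) = Valued.v c ∧ Valued.v (θ * (1 + c * y) + (c - θ)) = Valued.v c := by
  have hσθ1 : Valued.v (σ θ) ≤ 1 := by rw [hσ]; exact hθ1
  have hskew := valued_map_trace_add_trace_lt_one_of_unitary σ hσ hJ hJd hc0 hc hσc hX hg
  have hfix := valued_map_det_sub_det_lt_one_of_unitary_two σ hσ hJ hJd hc0 hc hσc hX hg
  have hyskew := valued_map_add_lt_one_of_unitary_one σ hσ hc0 hc hσc hy hu
  have htD : Valued.v (c - σ θ + σ θ) < 1 := by rw [sub_add_cancel]; exact hc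
  have htN : Valued.v (θ - θ) < 1 := by rw [sub_self, map_zero]; exact zero_lt_one
  have hcσ : Valued.v (c - σ θ) ≤ 1 := Valuation.map_sub_le _ hc.le hσθ1
  have hDm := valued_det_one_add_smul_eq_one_of_skew_hermitian σ hσ hθ1 hθ hX hskew hfix hdisc hcσ (Or.inl htD)
  have hNm := valued_det_one_add_smul_eq_one_of_skew_hermitian σ hσ hθ1 hθ hX hskew hfix hdisc hθ1 (Or.inr htN)
  have hDs := valued_one_add_mul_eq_one_of_skew_hermitian σ hσ hθ1 hθ hy hyskew (Or.inl htD)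
  have hNs := valued_one_add_mul_eq_one_of_skew_hermitian σ hσ hθ1 hθ hy hyskew (Or.inr htN)
  exact ⟨(valued_det_hermitianShift_denominators σ hDm hNm).1, (valued_det_hermitianShift_denominators σ hDm hNm).2,
    (valued_hermitianShift_denominators_one σ θ hDs hNs).1, (valued_hermitianShift_denominators_one σ θ hDs hNs).2⟩

/-! ## §5 The dictionary: the hermitian shift divides `|disc χ_g|` and `|χ_g(u)|` by `|c|²` — no `|2| = 1` -/

/-- **THE DISCRIMINANT DEPTH DROPS BY `|c|²`**: `|disc χ_{φg}|·|c|² = |disc χ_g|` for `φg = (θ•g + (c−θ)•1)((c−σθ)•g + σθ•1)⁻¹`, `θ + σθ = 1`, `0 < |c| < 1`,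
`|det((c−σθ)•g + σθ•1)| = |c|²` (§1 with `a a′ − b b′ = c(1−c)`; ★ `valued_disc_moebius_mul_of_valued_lt_one` without `h2`; inert reading `N ↦ N − 1`).
[cite: Flicker1998UnitaryFL, §6] [cite: Kottwitz1986BaseChangeUnits, §2 pp. 244–247] -/
theorem valued_disc_hermitianMoebius_mul (σ : K →+* K) {θ : K} (hθ : θ + σ θ = 1) {c : K} (hc0 : c ≠ 0) (hc1 : Valued.v c < 1) (g : Matrix (Fin 2) (Fin 2) K)
    (hD : Valued.v (((c - σ θ) • g + σ θ • (1 : Matrix (Fin 2) (Fin 2) K)).det) = Valued.v c ^ 2) :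
    Valued.v (((θ • g + (c - θ) • (1 : Matrix (Fin 2) (Fin 2) K)) * ((c - σ θ) • g + σ θ • (1 : Matrix (Fin 2) (Fin 2) K))⁻¹).trace ^ 2 -
        4 * ((θ • g + (c - θ) • (1 : Matrix (Fin 2) (Fin 2) K)) * ((c - σ θ) • g + σ θ • (1 : Matrix (Fin 2) (Fin 2) K))⁻¹).det) * Valued.v c ^ 2 =
      Valued.v (g.trace ^ 2 - 4 * g.det) := by
  have hvc0 : Valued.v c ≠ 0 := (Valuation.ne_zero_iff _).2 hc0
  have hpow0 : Valued.v c ^ 2 ≠ 0 := pow_ne_zero _ hvc0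
  have hD0 : ((c - σ θ) • g + σ θ • (1 : Matrix (Fin 2) (Fin 2) K)).det ≠ 0 := fun h => by
    rw [h, map_zero] at hD; exact hpow0 hD.symm
  have key := congrArg Valued.v (disc_genMoebius_fin_two g θ (c - θ) (σ θ) (c - σ θ) hD0)
  rw [map_mul, map_mul, map_pow, hD, valued_hermitianPair_key_scalar_sq σ hθ hc1] at key
  have e : Valued.v (((θ • g + (c - θ) • (1 : Matrix (Fin 2) (Fin 2) K)) * ((c - σ θ) • g + σ θ • (1 : Matrix (Fin 2) (Fin 2) K))⁻¹).trace ^ 2 -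
        4 * ((θ • g + (c - θ) • (1 : Matrix (Fin 2) (Fin 2) K)) * ((c - σ θ) • g + σ θ • (1 : Matrix (Fin 2) (Fin 2) K))⁻¹).det) * Valued.v c ^ 2 * Valued.v c ^ 2 =
      Valued.v (g.trace ^ 2 - 4 * g.det) * Valued.v c ^ 2 := by
    rw [mul_assoc, ← pow_two, key, mul_comm]
  exact mul_right_cancel₀ hpow0 e

/-- **THE DEPTH SUM DROPS BY `|c|²`**: `|χ_{φg}(φu)|·|c|² = |χ_g(u)|` with `φu = (θu + (c−θ))∕((c−σθ)u + σθ)`, when `|det((c−σθ)•g + σθ•1)| = |c|²` and `|(c−σθ)u + σθ| = |c|`,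
`θ + σθ = 1`, `0 < |c| < 1` (§1; ★ `valued_eval_charpoly_moebius_mul_of_valued_lt_one` without `h2`; inert reading `n ↦ n − 2`).
[cite: Flicker1998UnitaryFL, §6] [cite: Kottwitz1986BaseChangeUnits, §2 pp. 244–247] -/
theorem valued_eval_charpoly_hermitianMoebius_mul (σ : K →+* K) {θ : K} (hθ : θ + σ θ = 1) {c : K} (hc0 : c ≠ 0) (hc1 : Valued.v c < 1) (g : Matrix (Fin 2) (Fin 2) K) (u : K)
    (hD : Valued.v (((c - σ θ) • g + σ θ • (1 : Matrix (Fin 2) (Fin 2) K)).det) = Valued.v c ^ 2)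
    (hu : Valued.v ((c - σ θ) * u + σ θ) = Valued.v c) :
    Valued.v ((((θ • g + (c - θ) • (1 : Matrix (Fin 2) (Fin 2) K)) * ((c - σ θ) • g + σ θ • (1 : Matrix (Fin 2) (Fin 2) K))⁻¹).charpoly.eval
        ((θ * u + (c - θ)) / ((c - σ θ) * u + σ θ)))) * Valued.v c ^ 2 = Valued.v (g.charpoly.eval u) := by
  have hvc0 : Valued.v c ≠ 0 := (Valuation.ne_zero_iff _).2 hc0
  have hpow0 : Valued.v c ^ 2 ≠ 0 := pow_ne_zero _ hvc0
  have hD0 : ((c - σ θ) • g + σ θ • (1 : Matrix (Fin 2) (Fin 2) K)).det ≠ 0 := fun h => by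
    rw [h, map_zero] at hD; exact hpow0 hD.symm
  have hu0 : (c - σ θ) * u + σ θ ≠ 0 := fun h => by rw [h, map_zero] at hu; exact hvc0 hu.symm
  have key := congrArg Valued.v (eval_charpoly_genMoebius_fin_two g θ (c - θ) (σ θ) (c - σ θ) u hD0 hu0)
  rw [map_mul, map_mul, map_mul, map_pow, hD, hu, valued_hermitianPair_key_scalar_sq σ hθ hc1] at key
  have e : Valued.v ((((θ • g + (c - θ) • (1 : Matrix (Fin 2) (Fin 2) K)) * ((c - σ θ) • g + σ θ • (1 : Matrix (Fin 2) (Fin 2) K))⁻¹).charpoly.eval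
        ((θ * u + (c - θ)) / ((c - σ θ) * u + σ θ)))) * Valued.v c ^ 2 * Valued.v c ^ 2 = Valued.v (g.charpoly.eval u) * Valued.v c ^ 2 := by
    rw [key, mul_comm]
  exact mul_right_cancel₀ hpow0 e

end Valued

end Literature.NumberTheory.Automorphic.MoebiusShift

end
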